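import Summits.CriticalPhenomena.PercolationContinuityZ3.Theorems.PercNearOneGluingNoHeavyLowerTailSunflowerChainCertificateReps
import HarnessLib
import HarnessLib.Audit

/-!
# `NoHeavyLowerTail` (crux stmt-CriticalPhenomena-4575), chain certificates — FINITE VERIFICATION IV: soundness of the checker's bound
# (`X_loc ≤ F_loc`) and of its fast form

Support file (seat `prim-ineq-prove-1` gen 33; `--supports stmt-CriticalPhenomena-4575`); part of the kernel replay of
`ChainCert.ThreeBlockMedianCertificate` (files …ChainCertificate ⟵ …Structure ⟵ …Duality ⟵ …Local ⟵ …Enumeration ⟵ …Checker ⟵ …Reps ⟵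
…Sound ⟵ …Final ⟵ compiled-check files ⟵ …Holds).  No `sorry`, no named facts, nothing asserted about the crux.  The whole chain elaborates as
ONE file (HOME/code-g33/lean/File6dev.lean, rc 0); these tree files are consecutive verbatim slices of it.  Memo:
run/shared/lean/prim/prim-ineq-prove-1/FINDING-CHAINCERT-prove1-g33.md §4–§7.

CONTENTS.  `term_le_kT` (at every slot triple the checker's term is at most the abstract kernel `kT`), `Xloc_le_FlocT`; list algebra
`sum_map_ite_eq_length`, `sum_map_ite_filter`, `sum_aTermP`, and `Xloc_eq_fast` (the fast form computes `X_loc`).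
-/

namespace Summit.CriticalPhenomena.PercolationContinuityZ3.Theorems.SunflowerPartition

namespace ChainCert

open Finset

section FiniteCheck

variable {n : Fin 3 → ℕ}

/-- **Termwise soundness**: at every slot triple the checker's term is at most the abstract kernel. [this work] -/
theorem term_le_kT {b : Fin 3 → Bool × Bool} {D : LocalDatum} (hv : D.Valid (patPre b)) (x y z : J) :
    aTermP (cellsList D).toArray (repsList hv).toArray (mkRec x y z) +
      lbTermP b (canonTab b) (cellsList D).toArray (repsList hv).toArray
        (forcedP (medTab b (canonTab b)) (cellsList D).toArray (repsList hv).toArray (petOf (cellsList D).toArray)) (mkRec x y z) ≤ D.kT x y z := by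
  have repE : ∀ j j' : J, D.cell j = 1 → D.cell j' = 1 → (repOf hv (encN j) ≠ repOf hv (encN j') ↔ D.E j j' = false) := by
    intro j j' h h'
    have hd : D.cell (decN (encN j)) = 1 := by rw [decN_encN]; exact h
    have hd' : D.cell (decN (encN j')) = 1 := by rw [decN_encN]; exact h'
    have := repOf_eq_iff hv hd hd'
    rw [decN_encN, decN_encN] at this
    rw [Bool.eq_false_iff]; exact not_congr this
  -- the M-independent part is equal
  have hA : aTermP (cellsList D).toArray (repsList hv).toArray (mkRec x y z) =
      6 * (if D.cell x = 2 ∧ D.cell y = 2 ∧ D.cell z = 0 then 1 else 0)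
      - 3 * (if D.cell x = 2 ∧ D.cell y = 1 ∧ D.cell z = 1 ∧ D.E y z = false then 1 else 0)
      - (if D.cell x = 1 ∧ D.cell y = 1 ∧ D.cell z = 1 ∧ D.E x y = false ∧ D.E x z = false ∧ D.E y z = false then 1 else 0) := by
    simp only [aTermP, mkRec, cellsArray_getD, repsArray_getD]
    have e2 : (if D.cell x = 2 ∧ D.cell y = 1 ∧ D.cell z = 1 ∧ repOf hv (encN y) ≠ repOf hv (encN z) then (1 : ℤ) else 0) =
        (if D.cell x = 2 ∧ D.cell y = 1 ∧ D.cell z = 1 ∧ D.E y z = false then 1 else 0) := by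
      by_cases hy : D.cell y = 1
      · by_cases hz : D.cell z = 1
        · simp only [repE y z hy hz]
        · simp [hz]
      · simp [hy]
    have e3 : (if D.cell x = 1 ∧ D.cell y = 1 ∧ D.cell z = 1 ∧ repOf hv (encN x) ≠ repOf hv (encN y) ∧
          repOf hv (encN x) ≠ repOf hv (encN z) ∧ repOf hv (encN y) ≠ repOf hv (encN z) then (1 : ℤ) else 0) =
        (if D.cell x = 1 ∧ D.cell y = 1 ∧ D.cell z = 1 ∧ D.E x y = false ∧ D.E x z = false ∧ D.E y z = false then 1 else 0) := by
      by_cases hx : D.cell x = 1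
      · by_cases hy : D.cell y = 1
        · by_cases hz : D.cell z = 1
          · simp only [repE x y hx hy, repE x z hx hz, repE y z hy hz]
          · simp [hz]
        · simp [hy]
      · simp [hx]
    rw [e2, e3]
  -- the transfer part is bounded
  have hB : lbTermP b (canonTab b) (cellsList D).toArray (repsList hv).toArray
      (forcedP (medTab b (canonTab b)) (cellsList D).toArray (repsList hv).toArray (petOf (cellsList D).toArray)) (mkRec x y z) ≤
      - (6 * ((if D.M x y = true then 1 else 0) * ((if D.cell z = 2 then 1 else 0) - (if D.cell z = 0 then 1 else 0)))) := by
    have ez : (cellsList D).toArray.getD (mkRec x y z).pz 1 = D.cell z := by simp only [mkRec, cellsArray_getD]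
    have hz3 : D.cell z = 0 ∨ D.cell z = 1 ∨ D.cell z = 2 := by
      generalize D.cell z = v; revert v; decide
    have hcand : D.M x y = true → candP b (cellsList D).toArray (repsList hv).toArray (mkRec x y z) = true :=
      fun h => candP_of_M hv (z := z) h
    unfold lbTermP
    by_cases hpre : preCand b (cellsList D).toArray (mkRec x y z) = true
    · rw [if_pos hpre]
      unfold lbInner
      rw [ez]
      by_cases hF : isForced (canonTab b) (forcedP (medTab b (canonTab b)) (cellsList D).toArray (repsList hv).toArray (petOf (cellsList D).toArray))
          (mkRec x y z) = true
      · rw [if_pos hF, M_of_isForced hv hF]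
        rcases hz3 with h | h | h <;> simp [h]
      · rw [if_neg hF]
        by_cases hc : repCand (cellsList D).toArray (repsList hv).toArray (mkRec x y z) = true
        · rw [if_pos hc]
          by_cases hM : D.M x y = true
          · rw [hM]; rcases hz3 with h | h | h <;> simp [h]
          · have hM' : D.M x y = false := by simpa using hM
            rw [hM']; rcases hz3 with h | h | h <;> simp [h]
        · rw [if_neg hc]
          have hM' : D.M x y = false := by
            rw [Bool.eq_false_iff]; intro h
            have := hcand h; rw [candP, Bool.and_eq_true] at this; exact hc this.2
          rw [hM']; simp
    · rw [if_neg hpre]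
      have hM' : D.M x y = false := by
        rw [Bool.eq_false_iff]; intro h
        have := hcand h; rw [candP, Bool.and_eq_true] at this; exact hpre this.1
      rw [hM']; simp
  -- assemble
  unfold LocalDatum.kT
  linarith [hA, hB]

/-- **Soundness of the checker's bound.** [this work] -/
theorem Xloc_le_FlocT {b : Fin 3 → Bool × Bool} {D : LocalDatum} (hv : D.Valid (patPre b)) :
    Xloc b (canonTab b) (medTab b (canonTab b)) (cellsList D).toArray (repsList hv).toArray ≤ D.FlocT := by
  have hF : D.FlocT = slotSum (fun x y z => D.kT x y z) := by
    unfold LocalDatum.FlocT; exact sum_sym3_eq_slotSum _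
  rw [hF, slotSum_eq, Xloc, slotRecs, List.map_map]
  apply List.sum_le_sum
  intro t _
  exact term_le_kT hv t.1 t.2.1 t.2.2

/-- Sum of indicators = length of the filter (helper). [this work] -/
theorem sum_map_ite_eq_length {α : Type} (l : List α) (P : α → Prop) [DecidablePred P] :
    (l.map fun a => if P a then (1 : ℤ) else 0).sum = ((l.filter fun a => decide (P a)).length : ℤ) := by
  induction l with
  | nil => simp
  | cons a l ih =>
    simp only [List.map_cons, List.sum_cons, List.filter_cons, ih]
    by_cases h : P a <;> simp [h]
    omega

/-- Sum of guarded terms = sum over the filter (helper). [this work] -/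
theorem sum_map_ite_filter {α : Type} (l : List α) (P : α → Bool) (f : α → ℤ) :
    (l.map fun a => if P a = true then f a else 0).sum = ((l.filter P).map f).sum := by
  induction l with
  | nil => simp
  | cons a l ih =>
    simp only [List.map_cons, List.sum_cons, List.filter_cons, ih]
    cases P a <;> simp

/-- The `M`-independent terms summed over any list of slot records (helper). [this work] -/
theorem sum_aTermP (ca : Array (Fin 3)) (ra : Array ℕ) (l : List SlotRec) :
    (l.map (aTermP ca ra)).sum =
      6 * (l.map fun s => if ca.getD s.px 1 = 2 ∧ ca.getD s.py 1 = 2 ∧ ca.getD s.pz 1 = 0 then (1 : ℤ) else 0).sum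
      - 3 * (l.map fun s => if ca.getD s.px 1 = 2 ∧ ca.getD s.py 1 = 1 ∧ ca.getD s.pz 1 = 1 ∧ ra.getD s.py 0 ≠ ra.getD s.pz 0
          then (1 : ℤ) else 0).sum
      - (l.map fun s => if ca.getD s.px 1 = 1 ∧ ca.getD s.py 1 = 1 ∧ ca.getD s.pz 1 = 1 ∧ ra.getD s.px 0 ≠ ra.getD s.py 0 ∧
          ra.getD s.px 0 ≠ ra.getD s.pz 0 ∧ ra.getD s.py 0 ≠ ra.getD s.pz 0 then (1 : ℤ) else 0).sum := by
  induction l with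
  | nil => simp
  | cons a l ih =>
    simp only [List.map_cons, List.sum_cons, ih, aTermP]
    ring

/-- **The fast form computes `X_loc`.** [this work] -/
theorem Xloc_eq_fast (b : Fin 3 → Bool × Bool) (ct : Array ℕ) (mt : Array (ℕ × ℕ)) (ca : Array (Fin 3)) (ra : Array ℕ) :
    Xloc b ct mt ca ra = XlocFast ct mt ca (petOf ca) ((slotRecs.filter (pre220 ca)).length : ℤ) (slotRecs.filter (pre211 ca))
      (slotRecs.filter (pre111 ca)) (slotRecs.filter (preCand b ca)) ra := by
  unfold Xloc XlocFast
  dsimp only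
  rw [List.sum_map_add]
  have hA : (slotRecs.map (aTermP ca ra)).sum =
      6 * ((slotRecs.filter (pre220 ca)).length : ℤ) - 3 * (((slotRecs.filter (pre211 ca)).filter (rep211 ra)).length : ℤ)
        - (((slotRecs.filter (pre111 ca)).filter (rep111 ra)).length : ℤ) := by
    rw [sum_aTermP, sum_map_ite_eq_length, sum_map_ite_eq_length, sum_map_ite_eq_length]
    have f1 : slotRecs.filter (pre220 ca) = slotRecs.filter (fun s => decide (ca.getD s.px 1 = 2 ∧ ca.getD s.py 1 = 2 ∧
        ca.getD s.pz 1 = 0)) := rfl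
    have f2 : (slotRecs.filter (pre211 ca)).filter (rep211 ra) =
        slotRecs.filter (fun s => decide (ca.getD s.px 1 = 2 ∧ ca.getD s.py 1 = 1 ∧ ca.getD s.pz 1 = 1 ∧
          ra.getD s.py 0 ≠ ra.getD s.pz 0)) := by
      rw [List.filter_filter]
      apply List.filter_congr
      intro s _
      simp only [pre211, rep211, Bool.decide_and, ne_eq, decide_not]
      generalize decide (ca.getD s.px 1 = 2) = p₁
      generalize decide (ca.getD s.py 1 = 1) = p₂
      generalize decide (ca.getD s.pz 1 = 1) = p₃
      generalize decide (ra.getD s.py 0 = ra.getD s.pz 0) = p₄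
      cases p₁ <;> cases p₂ <;> cases p₃ <;> cases p₄ <;> rfl
    have f3 : (slotRecs.filter (pre111 ca)).filter (rep111 ra) =
        slotRecs.filter (fun s => decide (ca.getD s.px 1 = 1 ∧ ca.getD s.py 1 = 1 ∧ ca.getD s.pz 1 = 1 ∧
          ra.getD s.px 0 ≠ ra.getD s.py 0 ∧ ra.getD s.px 0 ≠ ra.getD s.pz 0 ∧ ra.getD s.py 0 ≠ ra.getD s.pz 0)) := by
      rw [List.filter_filter]
      apply List.filter_congr
      intro s _
      simp only [pre111, rep111, Bool.decide_and, ne_eq, decide_not]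
      generalize decide (ca.getD s.px 1 = 1) = p₁
      generalize decide (ca.getD s.py 1 = 1) = p₂
      generalize decide (ca.getD s.pz 1 = 1) = p₃
      generalize decide (ra.getD s.px 0 = ra.getD s.py 0) = p₄
      generalize decide (ra.getD s.px 0 = ra.getD s.pz 0) = p₅
      generalize decide (ra.getD s.py 0 = ra.getD s.pz 0) = p₆
      cases p₁ <;> cases p₂ <;> cases p₃ <;> cases p₄ <;> cases p₅ <;> cases p₆ <;> rfl
    rw [f1, f2, f3]
  have hB : (slotRecs.map (lbTermP b ct ca ra (forcedP mt ca ra (petOf ca)))).sum =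
      ((slotRecs.filter (preCand b ca)).map (lbInner ct ca ra (forcedP mt ca ra (petOf ca)))).sum := by
    rw [← sum_map_ite_filter]; rfl
  rw [hA, hB]


end FiniteCheck

end ChainCert

end Summit.CriticalPhenomena.PercolationContinuityZ3.Theorems.SunflowerPartition
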